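import Summits.CriticalPhenomena.PercolationContinuityZ3.Theorems.PercAnnulusCrossingIICExponentPhaseDiagram
import HarnessLib

/-!
# Shifted sandwiches preserve log-exponents (lane RSW3, p1 gen 14)

Seat `prim-rsw3-p1` (gen 14); memo `run/shared/lean/prim/rsw3/P1-QM.md` §27.  Helper file for the crux `stmt-CriticalPhenomena-4575`
chain; no definitions, no sorries; deterministic real analysis used by `…IICIntrinsicVolumeExponent` (the intrinsic-ball volume of Kesten's
IIC admits only a SHIFTED far sandwich `F ≤ b + G`, `G ≤ F(· + B)`, which gen 14's additive engine does not cover).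

For sequences `F, G : ℕ → ℕ` and the exponent sequences `e^F_r = log F_r / log(r+2)`, `e^G_r` (valued in `[0,∞]` via `ENNReal.ofReal`):

* `log_div_log_le_of_le_mul_rpow` — `F ≤ M (r+2)^{α'}` ⇒ `e^F_r ≤ α' + log M / log(r+2)`; `exists_btwn_of_lt_ofReal`;
* **`limsup_log_le_of_le_add`**, **`liminf_log_le_of_le_add`** — `F ≤ b + G` eventually ⇒ (`limsup/liminf e^G < α ⇒ limsup/liminf e^F ≤ α`);
* **`limsup_log_le_of_le_shift`**, **`liminf_log_le_of_le_shift`** — `G ≤ F(· + B)` eventually ⇒ (`limsup/liminf e^F < α ⇒ limsup/liminf e^G ≤ α`)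
  (the index shift costs a factor `(B+1)^{α'}`, invisible at the log scale);
* **`limsup_log_eq_of_shifted_sandwich`**, **`liminf_log_eq_of_shifted_sandwich`** — both ⇒ `limsup e^F = limsup e^G`, `liminf e^F = liminf e^G`.

References: folklore real analysis; H.-O. Georgii (2011), Prop. 7.9 (the use).
-/

noncomputable section

namespace Summit.CriticalPhenomena.PercolationContinuityZ3.Theorems.Crossing

open MeasureTheory Filter Topology Literature.Probability.Percolation Literature.Probability.LatticeModels
open Literature.Probability.Percolation.DCT16 Literature.Probability.Percolation.DKT20
open Summit.CriticalPhenomena.PercolationContinuityZ3.Theorems.SurfaceTension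
open scoped Literature.Probability.Percolation ENNReal symmDiff

variable {d : ℕ}


/-! ## Generic: shifted sandwiches preserve log-exponents -/

/-- `F ≤ M (r+2)^{α'}` with `M ≥ 1`, `α' ≥ 0` ⇒ `log F / log(r+2) ≤ α' + log M / log(r+2)` (naturals `F`). [folklore] -/
theorem log_div_log_le_of_le_mul_rpow (F r : ℕ) {M α' : ℝ} (hM : 1 ≤ M) (hα' : 0 ≤ α')
    (h : (F : ℝ) ≤ M * ((r : ℝ) + 2) ^ α') :
    Real.log (F : ℝ) / Real.log ((r : ℝ) + 2) ≤ α' + Real.log M / Real.log ((r : ℝ) + 2) := by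
  have h2 : 0 < Real.log ((r : ℝ) + 2) := Real.log_pos (by linarith [(Nat.cast_nonneg r : (0 : ℝ) ≤ r)])
  have hr2 : (0 : ℝ) < (r : ℝ) + 2 := by positivity
  have hM0 : 0 ≤ Real.log M := Real.log_nonneg hM
  rcases Nat.eq_zero_or_pos F with h0 | hpos
  · rw [h0, Nat.cast_zero, Real.log_zero, zero_div]; positivity
  · have hlog : Real.log (F : ℝ) ≤ Real.log M + α' * Real.log ((r : ℝ) + 2) := by
      calc Real.log (F : ℝ) ≤ Real.log (M * ((r : ℝ) + 2) ^ α') := Real.log_le_log (by exact_mod_cast hpos) h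
        _ = Real.log M + α' * Real.log ((r : ℝ) + 2) := by
            rw [Real.log_mul (by positivity) (by positivity), Real.log_rpow hr2]
    rw [div_le_iff₀ h2, add_mul, div_mul_cancel₀ _ h2.ne']
    linarith

/-- An intermediate exponent: `E < α` (`E ∈ [0,∞]`, `α` real) gives `α' ∈ (0, α)` real with `E < α'`. [folklore] -/
theorem exists_btwn_of_lt_ofReal {E : ℝ≥0∞} {α : ℝ} (h : E < ENNReal.ofReal α) :
    ∃ α' : ℝ, 0 < α' ∧ α' < α ∧ E < ENNReal.ofReal α' := by
  have hα : 0 < α := ENNReal.ofReal_pos.1 (lt_of_le_of_lt bot_le h)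
  have hEtop : E ≠ ⊤ := ne_top_of_lt h
  have hEα : E.toReal < α := ENNReal.toReal_lt_of_lt_ofReal h
  refine ⟨(max E.toReal (α / 2) + α) / 2, by positivity, ?_, ?_⟩
  · have : max E.toReal (α / 2) < α := max_lt hEα (by linarith)
    linarith
  · rw [ENNReal.lt_ofReal_iff_toReal_lt hEtop]
    have : E.toReal ≤ max E.toReal (α / 2) := le_max_left _ _
    have : max E.toReal (α / 2) < α := max_lt hEα (by linarith)
    linarith

/-- **`F ≤ b + G` eventually ⇒ the upper log-exponent of `F` is at most that of `G`** (one-sided form: `limsup e_G < α ⇒ limsup e_F ≤ α`). [folklore] -/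
theorem limsup_log_le_of_le_add (F G : ℕ → ℕ) {b r₀ : ℕ} (h1 : ∀ r, r₀ ≤ r → F r ≤ b + G r) {α : ℝ}
    (h : limsup (fun r => ENNReal.ofReal (Real.log (G r : ℝ) / Real.log ((r : ℝ) + 2))) atTop < ENNReal.ofReal α) :
    limsup (fun r => ENNReal.ofReal (Real.log (F r : ℝ) / Real.log ((r : ℝ) + 2))) atTop ≤ ENNReal.ofReal α := by
  obtain ⟨α', hα'0, hα'α, hE⟩ := exists_btwn_of_lt_ofReal h
  have hlog : Tendsto (fun r : ℕ => Real.log ((r : ℝ) + 2)) atTop atTop :=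
    Real.tendsto_log_atTop.comp (tendsto_atTop_add_const_right _ _ tendsto_natCast_atTop_atTop)
  set M : ℝ := (b : ℝ) + 1 with hMdef
  have hM : 1 ≤ M := by rw [hMdef]; linarith [(Nat.cast_nonneg b : (0 : ℝ) ≤ b)]
  have hev : ∀ᶠ r : ℕ in atTop, ENNReal.ofReal (Real.log (G r : ℝ) / Real.log ((r : ℝ) + 2)) < ENNReal.ofReal α' :=
    eventually_lt_of_limsup_lt hE
  have hsmall : ∀ᶠ r : ℕ in atTop, Real.log M / (α - α') ≤ Real.log ((r : ℝ) + 2) := hlog.eventually_ge_atTop _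
  refine limsup_le_of_le (by isBoundedDefault) ?_
  filter_upwards [hev, hsmall, Filter.eventually_ge_atTop r₀] with r hr hrs hr₀
  have h2 : 0 < Real.log ((r : ℝ) + 2) := Real.log_pos (by linarith [(Nat.cast_nonneg r : (0 : ℝ) ≤ r)])
  have he : Real.log (G r : ℝ) / Real.log ((r : ℝ) + 2) < α' := by
    have h' := ENNReal.toReal_lt_of_lt_ofReal hr
    rwa [ENNReal.toReal_ofReal (div_nonneg (Real.log_natCast_nonneg _) h2.le)] at h'
  have hG : (G r : ℝ) ≤ ((r : ℝ) + 2) ^ α' := natCast_le_rpow_of_log_div_lt (G r) r he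
  have hF : (F r : ℝ) ≤ M * ((r : ℝ) + 2) ^ α' := by
    have h1r : (F r : ℝ) ≤ b + G r := by exact_mod_cast h1 r hr₀
    have hone : 1 ≤ ((r : ℝ) + 2) ^ α' := Real.one_le_rpow (by linarith [(Nat.cast_nonneg r : (0 : ℝ) ≤ r)]) hα'0.le
    rw [hMdef]; nlinarith
  have hratio := log_div_log_le_of_le_mul_rpow (F r) r hM hα'0.le hF
  have hq : Real.log M / Real.log ((r : ℝ) + 2) ≤ α - α' := by
    rw [div_le_iff₀ h2]; rw [div_le_iff₀ (by linarith)] at hrs; linarith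
  exact ENNReal.ofReal_le_ofReal (by linarith)

/-- **`G ≤ F(· + B)` eventually ⇒ the upper log-exponent of `G` is at most that of `F`** (`limsup e_F < α ⇒ limsup e_G ≤ α`). [folklore] -/
theorem limsup_log_le_of_le_shift (F G : ℕ → ℕ) {B r₀ : ℕ} (hGF : ∀ r, r₀ ≤ r → G r ≤ F (r + B)) {α : ℝ}
    (h : limsup (fun r => ENNReal.ofReal (Real.log (F r : ℝ) / Real.log ((r : ℝ) + 2))) atTop < ENNReal.ofReal α) :
    limsup (fun r => ENNReal.ofReal (Real.log (G r : ℝ) / Real.log ((r : ℝ) + 2))) atTop ≤ ENNReal.ofReal α := by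
  obtain ⟨α', hα'0, hα'α, hE⟩ := exists_btwn_of_lt_ofReal h
  have hlog : Tendsto (fun r : ℕ => Real.log ((r : ℝ) + 2)) atTop atTop :=
    Real.tendsto_log_atTop.comp (tendsto_atTop_add_const_right _ _ tendsto_natCast_atTop_atTop)
  set M : ℝ := ((B : ℝ) + 1) ^ α' with hMdef
  have hM : 1 ≤ M := Real.one_le_rpow (by linarith [(Nat.cast_nonneg B : (0 : ℝ) ≤ B)]) hα'0.le
  have hev : ∀ᶠ s : ℕ in atTop, ENNReal.ofReal (Real.log (F s : ℝ) / Real.log ((s : ℝ) + 2)) < ENNReal.ofReal α' :=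
    eventually_lt_of_limsup_lt hE
  -- shift the eventual statement from `s` to `r = s - B`
  have hev' : ∀ᶠ r : ℕ in atTop, (F (r + B) : ℝ) ≤ (((r + B : ℕ) : ℝ) + 2) ^ α' := by
    obtain ⟨s₀, hs₀⟩ := Filter.eventually_atTop.1 hev
    refine Filter.eventually_atTop.2 ⟨s₀, fun r hr => ?_⟩
    have hs := hs₀ (r + B) (by omega)
    have h2 : 0 < Real.log ((((r + B : ℕ)) : ℝ) + 2) := Real.log_pos (by
      have := (Nat.cast_nonneg (r + B) : (0 : ℝ) ≤ ((r + B : ℕ) : ℝ)); linarith)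
    have he : Real.log (F (r + B) : ℝ) / Real.log (((r + B : ℕ) : ℝ) + 2) < α' := by
      have h' := ENNReal.toReal_lt_of_lt_ofReal hs
      rwa [ENNReal.toReal_ofReal (div_nonneg (Real.log_natCast_nonneg _) h2.le)] at h'
    exact natCast_le_rpow_of_log_div_lt (F (r + B)) (r + B) he
  have hsmall : ∀ᶠ r : ℕ in atTop, Real.log M / (α - α') ≤ Real.log ((r : ℝ) + 2) := hlog.eventually_ge_atTop _
  refine limsup_le_of_le (by isBoundedDefault) ?_
  filter_upwards [hev', hsmall, Filter.eventually_ge_atTop r₀] with r hr hrs hr₀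
  have h2 : 0 < Real.log ((r : ℝ) + 2) := Real.log_pos (by linarith [(Nat.cast_nonneg r : (0 : ℝ) ≤ r)])
  have hr0 : (0 : ℝ) ≤ r := Nat.cast_nonneg r
  have hshift : (((r + B : ℕ) : ℝ) + 2) ^ α' ≤ M * ((r : ℝ) + 2) ^ α' := by
    rw [hMdef, ← Real.mul_rpow (by linarith [(Nat.cast_nonneg B : (0 : ℝ) ≤ B)]) (by linarith)]
    refine Real.rpow_le_rpow (by positivity) ?_ hα'0.le
    push_cast
    nlinarith [(Nat.cast_nonneg B : (0 : ℝ) ≤ B)]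
  have hG : (G r : ℝ) ≤ M * ((r : ℝ) + 2) ^ α' := by
    have h2r : (G r : ℝ) ≤ F (r + B) := by exact_mod_cast hGF r hr₀
    exact h2r.trans (hr.trans hshift)
  have hratio := log_div_log_le_of_le_mul_rpow (G r) r hM hα'0.le hG
  have hq : Real.log M / Real.log ((r : ℝ) + 2) ≤ α - α' := by
    rw [div_le_iff₀ h2]; rw [div_le_iff₀ (by linarith)] at hrs; linarith
  exact ENNReal.ofReal_le_ofReal (by linarith)

/-- **`F ≤ b + G` eventually ⇒ `liminf e_G < α ⇒ liminf e_F ≤ α`**. [folklore] -/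
theorem liminf_log_le_of_le_add (F G : ℕ → ℕ) {b r₀ : ℕ} (h1 : ∀ r, r₀ ≤ r → F r ≤ b + G r) {α : ℝ}
    (h : liminf (fun r => ENNReal.ofReal (Real.log (G r : ℝ) / Real.log ((r : ℝ) + 2))) atTop < ENNReal.ofReal α) :
    liminf (fun r => ENNReal.ofReal (Real.log (F r : ℝ) / Real.log ((r : ℝ) + 2))) atTop ≤ ENNReal.ofReal α := by
  obtain ⟨α', hα'0, hα'α, hE⟩ := exists_btwn_of_lt_ofReal h
  have hlog : Tendsto (fun r : ℕ => Real.log ((r : ℝ) + 2)) atTop atTop :=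
    Real.tendsto_log_atTop.comp (tendsto_atTop_add_const_right _ _ tendsto_natCast_atTop_atTop)
  set M : ℝ := (b : ℝ) + 1 with hMdef
  have hM : 1 ≤ M := by rw [hMdef]; linarith [(Nat.cast_nonneg b : (0 : ℝ) ≤ b)]
  have hfreq : ∃ᶠ r : ℕ in atTop, ENNReal.ofReal (Real.log (G r : ℝ) / Real.log ((r : ℝ) + 2)) < ENNReal.ofReal α' :=
    frequently_lt_of_liminf_lt (by isBoundedDefault) hE
  have hsmall : ∀ᶠ r : ℕ in atTop, Real.log M / (α - α') ≤ Real.log ((r : ℝ) + 2) := hlog.eventually_ge_atTop _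
  refine liminf_le_of_frequently_le ?_ (by isBoundedDefault)
  refine (hfreq.and_eventually (hsmall.and (Filter.eventually_ge_atTop r₀))).mono fun r hr => ?_
  obtain ⟨hr, hrs, hr₀⟩ := hr
  have h2 : 0 < Real.log ((r : ℝ) + 2) := Real.log_pos (by linarith [(Nat.cast_nonneg r : (0 : ℝ) ≤ r)])
  have he : Real.log (G r : ℝ) / Real.log ((r : ℝ) + 2) < α' := by
    have h' := ENNReal.toReal_lt_of_lt_ofReal hr
    rwa [ENNReal.toReal_ofReal (div_nonneg (Real.log_natCast_nonneg _) h2.le)] at h'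
  have hG : (G r : ℝ) ≤ ((r : ℝ) + 2) ^ α' := natCast_le_rpow_of_log_div_lt (G r) r he
  have hF : (F r : ℝ) ≤ M * ((r : ℝ) + 2) ^ α' := by
    have h1r : (F r : ℝ) ≤ b + G r := by exact_mod_cast h1 r hr₀
    have hone : 1 ≤ ((r : ℝ) + 2) ^ α' := Real.one_le_rpow (by linarith [(Nat.cast_nonneg r : (0 : ℝ) ≤ r)]) hα'0.le
    rw [hMdef]; nlinarith
  have hratio := log_div_log_le_of_le_mul_rpow (F r) r hM hα'0.le hF
  have hq : Real.log M / Real.log ((r : ℝ) + 2) ≤ α - α' := by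
    rw [div_le_iff₀ h2]; rw [div_le_iff₀ (by linarith)] at hrs; linarith
  exact ENNReal.ofReal_le_ofReal (by linarith)

/-- **`G ≤ F(· + B)` eventually ⇒ `liminf e_F < α ⇒ liminf e_G ≤ α`** (the index shift is absorbed by `log(r+B+2)/log(r+2) → 1`). [folklore] -/
theorem liminf_log_le_of_le_shift (F G : ℕ → ℕ) {B r₀ : ℕ} (hGF : ∀ r, r₀ ≤ r → G r ≤ F (r + B)) {α : ℝ}
    (h : liminf (fun r => ENNReal.ofReal (Real.log (F r : ℝ) / Real.log ((r : ℝ) + 2))) atTop < ENNReal.ofReal α) :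
    liminf (fun r => ENNReal.ofReal (Real.log (G r : ℝ) / Real.log ((r : ℝ) + 2))) atTop ≤ ENNReal.ofReal α := by
  obtain ⟨α', hα'0, hα'α, hE⟩ := exists_btwn_of_lt_ofReal h
  have hlog : Tendsto (fun r : ℕ => Real.log ((r : ℝ) + 2)) atTop atTop :=
    Real.tendsto_log_atTop.comp (tendsto_atTop_add_const_right _ _ tendsto_natCast_atTop_atTop)
  set M : ℝ := ((B : ℝ) + 1) ^ α' with hMdef
  have hM : 1 ≤ M := Real.one_le_rpow (by linarith [(Nat.cast_nonneg B : (0 : ℝ) ≤ B)]) hα'0.le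
  have hfreq : ∃ᶠ s : ℕ in atTop, ENNReal.ofReal (Real.log (F s : ℝ) / Real.log ((s : ℝ) + 2)) < ENNReal.ofReal α' :=
    frequently_lt_of_liminf_lt (by isBoundedDefault) hE
  obtain ⟨N, hN⟩ := Filter.eventually_atTop.1 (hlog.eventually_ge_atTop (Real.log M / (α - α')))
  refine liminf_le_of_frequently_le ?_ (by isBoundedDefault)
  refine Filter.frequently_atTop.2 fun a => ?_
  obtain ⟨s, hs, hFs⟩ := Filter.frequently_atTop.1 hfreq (a + B + r₀ + N)
  refine ⟨s - B, by omega, ?_⟩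
  set r := s - B with hrdef
  have hsr : r + B = s := by omega
  have hr₀ : r₀ ≤ r := by omega
  have hrN : N ≤ r := by omega
  have h2 : 0 < Real.log ((r : ℝ) + 2) := Real.log_pos (by linarith [(Nat.cast_nonneg r : (0 : ℝ) ≤ r)])
  have h2s : 0 < Real.log ((s : ℝ) + 2) := Real.log_pos (by linarith [(Nat.cast_nonneg s : (0 : ℝ) ≤ s)])
  have he : Real.log (F s : ℝ) / Real.log ((s : ℝ) + 2) < α' := by
    have h' := ENNReal.toReal_lt_of_lt_ofReal hFs
    rwa [ENNReal.toReal_ofReal (div_nonneg (Real.log_natCast_nonneg _) h2s.le)] at h'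
  have hF : (F s : ℝ) ≤ ((s : ℝ) + 2) ^ α' := natCast_le_rpow_of_log_div_lt (F s) s he
  have hshift : ((s : ℝ) + 2) ^ α' ≤ M * ((r : ℝ) + 2) ^ α' := by
    rw [hMdef, ← Real.mul_rpow (by linarith [(Nat.cast_nonneg B : (0 : ℝ) ≤ B)]) (by linarith [(Nat.cast_nonneg r : (0 : ℝ) ≤ r)])]
    refine Real.rpow_le_rpow (by positivity) ?_ hα'0.le
    have : (s : ℝ) = r + B := by rw [← hsr]; push_cast; ring
    rw [this]
    nlinarith [(Nat.cast_nonneg B : (0 : ℝ) ≤ B), (Nat.cast_nonneg r : (0 : ℝ) ≤ r)]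
  have hG : (G r : ℝ) ≤ M * ((r : ℝ) + 2) ^ α' := by
    have h2r : (G r : ℝ) ≤ F (r + B) := by exact_mod_cast hGF r hr₀
    rw [hsr] at h2r
    exact h2r.trans (hF.trans hshift)
  have hratio := log_div_log_le_of_le_mul_rpow (G r) r hM hα'0.le hG
  have hrs := hN r hrN
  have hq : Real.log M / Real.log ((r : ℝ) + 2) ≤ α - α' := by
    rw [div_le_iff₀ h2]; rw [div_le_iff₀ (by linarith)] at hrs; linarith
  exact ENNReal.ofReal_le_ofReal (by linarith)

/-- **A shifted sandwich preserves the upper log-exponent**: `F ≤ b + G` and `G ≤ F(· + B)` eventually ⇒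
`limsup log F_r/log(r+2) = limsup log G_r/log(r+2)`. [folklore] -/
theorem limsup_log_eq_of_shifted_sandwich (F G : ℕ → ℕ) {b B r₀ : ℕ} (h1 : ∀ r, r₀ ≤ r → F r ≤ b + G r)
    (hGF : ∀ r, r₀ ≤ r → G r ≤ F (r + B)) :
    limsup (fun r => ENNReal.ofReal (Real.log (F r : ℝ) / Real.log ((r : ℝ) + 2))) atTop =
      limsup (fun r => ENNReal.ofReal (Real.log (G r : ℝ) / Real.log ((r : ℝ) + 2))) atTop := by
  apply le_antisymm
  · by_contra hlt
    push Not at hlt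
    obtain ⟨α, -, hα1, hα2⟩ := ENNReal.lt_iff_exists_real_btwn.1 hlt
    exact absurd (limsup_log_le_of_le_add F G h1 hα1) (not_le.2 hα2)
  · by_contra hlt
    push Not at hlt
    obtain ⟨α, -, hα1, hα2⟩ := ENNReal.lt_iff_exists_real_btwn.1 hlt
    exact absurd (limsup_log_le_of_le_shift F G hGF hα1) (not_le.2 hα2)

/-- **A shifted sandwich preserves the lower log-exponent**: `liminf log F_r/log(r+2) = liminf log G_r/log(r+2)`. [folklore] -/
theorem liminf_log_eq_of_shifted_sandwich (F G : ℕ → ℕ) {b B r₀ : ℕ} (h1 : ∀ r, r₀ ≤ r → F r ≤ b + G r)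
    (hGF : ∀ r, r₀ ≤ r → G r ≤ F (r + B)) :
    liminf (fun r => ENNReal.ofReal (Real.log (F r : ℝ) / Real.log ((r : ℝ) + 2))) atTop =
      liminf (fun r => ENNReal.ofReal (Real.log (G r : ℝ) / Real.log ((r : ℝ) + 2))) atTop := by
  apply le_antisymm
  · by_contra hlt
    push Not at hlt
    obtain ⟨α, -, hα1, hα2⟩ := ENNReal.lt_iff_exists_real_btwn.1 hlt
    exact absurd (liminf_log_le_of_le_add F G h1 hα1) (not_le.2 hα2)
  · by_contra hlt
    push Not at hlt
    obtain ⟨α, -, hα1, hα2⟩ := ENNReal.lt_iff_exists_real_btwn.1 hlt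
    exact absurd (liminf_log_le_of_le_shift F G hGF hα1) (not_le.2 hα2)

end Summit.CriticalPhenomena.PercolationContinuityZ3.Theorems.Crossing

end
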